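import Literature.NumberTheory.Sieve.MitsuiTotallyReal
import HarnessLib

/-!
# The level-of-distribution error of the box primes through character sums (Bombieri–Vinogradov
over `𝓞_K`, Step A)

Topic `Literature/NumberTheory/Sieve`. The first, elementary step of every proof of a
Bombieri–Vinogradov theorem for the prime elements `π` of the boxes `A(N)` of a number field
(Hinz 1988; over `ℤ`: Davenport ch. 28, Cojocaru–Murty (9.30)) — orthogonality of the characters
of `(𝓞_K/𝔮)ˣ`:

* `primeCharSum K N 𝔮 χ = ∑_{π ∈ A(N) prime} χ(π mod 𝔮)` (`0` on the classes not prime to `𝔮`);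
* `primesAModQ_eq_sum` — `|P(N; 𝔮, u)| = φ(𝔮)⁻¹ ∑_χ χ(u)⁻¹ S(N, 𝔮, χ)`;
* `primesA_eq` — `|P(N)| = S(N, 𝔮, χ₀) + #{π ∈ P(N) : π not prime to 𝔮}`;
* **`primesAErr_le`** — `𝓔(N; 𝔮) ≤ φ(𝔮)⁻¹ (∑_{χ ≠ χ₀} |S(N, 𝔮, χ)| + #{π ∈ P(N) : (π) ∣ 𝔮})`;
* `badPrimes_le` — for totally real `K` and `N ≥ 1`, `#{π ∈ P(N) : (π) ∣ 𝔮} ≤ ω(𝔮) · C_K (1 + log(2N))^{d−1}`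
  (each prime ideal `𝔭 ∣ 𝔮` has `≪ (log N)^{d−1}` generators in `A₀(2N)`, `MitsuiPNT.card_fiber` and
  `MitsuiSum.exists_shapeFun_le`).

Consequently the level of distribution `θ` of the box primes (`MaynardNF.PrimesHaveLevel K θ`,
Castillo et al. §2.1; Hinz's theorem = `θ < 1/2` for totally real `K`) is exactly a mean-value bound
for the character sums `S(N, 𝔮, χ)`, `χ ≠ χ₀`, over `N𝔮 ≤ |A(N)|^θ`. Everything here is PROVED.

## References

* J. Hinz, *A generalization of Bombieri's prime number theorem to algebraic number fields*, Acta
  Arith. 51 (1988), 173–193. [cite: Hinz1988, §1]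
* A. C. Cojocaru, M. R. Murty, *An introduction to sieve methods and their applications*, CUP 2005,
  (9.30). [cite: CojocaruMurty2005, Thm. 9.2.1 (PDF p. 98)]
-/

noncomputable section

open Filter NumberField NumberField.InfinitePlace NumberField.mixedEmbedding NumberField.Units
  NumberField.Units.dirichletUnitTheorem IsDedekindDomain Finset Topology Module UniqueFactorizationMonoid
open Literature.Algebra.EuclideanLattices Literature.Algebra.EuclideanLattices.LatticePeriodic
  Literature.Algebra.EuclideanLattices.MitsuiSum
open Literature.NumberTheory.LFunctions.AbelianDensity Literature.NumberTheory.LFunctions.HeckeCone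
  Literature.NumberTheory.Sieve.CastilloEtAl2015 Literature.NumberTheory.Sieve.MaynardNF
  Literature.NumberTheory.Sieve.MitsuiPNT

open scoped Classical Real Pointwise

namespace Literature.NumberTheory.Sieve.BoxPrimes

variable {K : Type*} [Field K] [NumberField K]

/-! ## Characters of `(𝓞_K/𝔮)ˣ` on residue classes -/

/-- The (finite) set of characters of `(𝓞_K/𝔮)ˣ`. [folklore] -/
instance instFintypeAddCharUnitsQuot (𝔮 : Ideal (𝓞 K)) [Finite ((𝓞 K ⧸ 𝔮)ˣ)] :
    Fintype (AddChar (Additive ((𝓞 K ⧸ 𝔮)ˣ)) ℂ) :=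
  @AddChar.instFintype (Additive ((𝓞 K ⧸ 𝔮)ˣ)) ℂ _ _ _

/-- The value of a character of `(𝓞_K/𝔮)ˣ` at a residue class, `0` on the non-units. [folklore] -/
def unitValue {𝔮 : Ideal (𝓞 K)} (χ : AddChar (Additive ((𝓞 K ⧸ 𝔮)ˣ)) ℂ) (x : 𝓞 K ⧸ 𝔮) : ℂ :=
  if h : IsUnit x then toMulHom χ h.unit else 0

omit [NumberField K] in
/-- On a unit the value is the character value. [folklore] -/
theorem unitValue_coe {𝔮 : Ideal (𝓞 K)} (χ : AddChar (Additive ((𝓞 K ⧸ 𝔮)ˣ)) ℂ) (u : (𝓞 K ⧸ 𝔮)ˣ) :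
    unitValue χ (u : 𝓞 K ⧸ 𝔮) = toMulHom χ u := by
  rw [unitValue, dif_pos u.isUnit, IsUnit.unit_of_val_units]

omit [NumberField K] in
/-- On a non-unit the value is `0`. [folklore] -/
theorem unitValue_of_not_isUnit {𝔮 : Ideal (𝓞 K)} (χ : AddChar (Additive ((𝓞 K ⧸ 𝔮)ˣ)) ℂ) {x : 𝓞 K ⧸ 𝔮}
    (hx : ¬ IsUnit x) : unitValue χ x = 0 := by
  rw [unitValue, dif_neg hx]

omit [NumberField K] in
/-- The trivial character is `1` on the units. [folklore] -/
theorem unitValue_zero_of_isUnit {𝔮 : Ideal (𝓞 K)} {x : 𝓞 K ⧸ 𝔮} (hx : IsUnit x) :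
    unitValue (0 : AddChar (Additive ((𝓞 K ⧸ 𝔮)ˣ)) ℂ) x = 1 := by
  rw [unitValue, dif_pos hx, toMulHom_apply, AddChar.zero_apply]

omit [NumberField K] in
/-- Character values are bounded by `1`. [folklore] -/
theorem norm_unitValue_le {𝔮 : Ideal (𝓞 K)} [Finite ((𝓞 K ⧸ 𝔮)ˣ)] (χ : AddChar (Additive ((𝓞 K ⧸ 𝔮)ˣ)) ℂ)
    (x : 𝓞 K ⧸ 𝔮) : ‖unitValue χ x‖ ≤ 1 := by
  by_cases hx : IsUnit x
  · rw [unitValue, dif_pos hx, norm_toMulHom]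
  · rw [unitValue_of_not_isUnit χ hx, norm_zero]; exact zero_le_one

variable (K) in
/-- **The character sums over the box primes**: `S(N, 𝔮, χ) = ∑_{π ∈ A(N) prime} χ(π mod 𝔮)`.
[cite: Hinz1988, §1] -/
def primeCharSum (N : ℝ) (𝔮 : Ideal (𝓞 K)) (χ : AddChar (Additive ((𝓞 K ⧸ 𝔮)ˣ)) ℂ) : ℂ :=
  ∑ p ∈ (regionF K N).filter Prime, unitValue χ (Ideal.Quotient.mk 𝔮 p)

variable (K) in
/-- The primes of `A(N)` not prime to `𝔮` (those generating a prime divisor of `𝔮`). [folklore] -/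
def badPrimes (N : ℝ) (𝔮 : Ideal (𝓞 K)) : ℕ :=
  ((regionF K N).filter fun p ↦ Prime p ∧ ¬ IsUnit (Ideal.Quotient.mk 𝔮 p)).card

/-! ## Orthogonality -/

/-- **Orthogonality**: `|P(N; 𝔮, u)| = φ(𝔮)⁻¹ ∑_χ χ(u)⁻¹ S(N, 𝔮, χ)` for a unit class `u`.
[cite: CojocaruMurty2005, Thm. 9.2.1 (PDF p. 98)] -/
theorem primesAModQ_eq_sum {𝔮 : Ideal (𝓞 K)} [Finite ((𝓞 K ⧸ 𝔮)ˣ)] (N : ℝ) (u : (𝓞 K ⧸ 𝔮)ˣ) :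
    (primesAModQ K N 𝔮 (u : 𝓞 K ⧸ 𝔮) : ℂ) =
      ((Nat.card ((𝓞 K ⧸ 𝔮)ˣ) : ℂ))⁻¹ * ∑ χ : AddChar (Additive ((𝓞 K ⧸ 𝔮)ˣ)) ℂ,
        (χ (Additive.ofMul u))⁻¹ * primeCharSum K N 𝔮 χ := by
  have hG : (Nat.card ((𝓞 K ⧸ 𝔮)ˣ) : ℂ) ≠ 0 := by exact_mod_cast Nat.card_pos.ne'
  unfold primesAModQ primeCharSum
  have hfil : (regionF K N).filter (fun p ↦ Prime p ∧ Ideal.Quotient.mk 𝔮 p = (u : 𝓞 K ⧸ 𝔮)) =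
      ((regionF K N).filter Prime).filter (fun p ↦ Ideal.Quotient.mk 𝔮 p = (u : 𝓞 K ⧸ 𝔮)) := by
    rw [Finset.filter_filter]
  rw [hfil, ← Finset.sum_boole]
  simp_rw [Finset.mul_sum]
  rw [Finset.sum_comm]
  refine Finset.sum_congr rfl fun p _ ↦ ?_
  rw [← Finset.mul_sum]
  by_cases hunit : IsUnit (Ideal.Quotient.mk 𝔮 p)
  · obtain ⟨g, hg⟩ := hunit
    simp only [← hg, unitValue_coe]
    rw [sum_char_inv_mul u g]
    by_cases hgu : g = u
    · subst hgu
      rw [if_pos rfl, if_pos rfl, inv_mul_cancel₀ hG]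
    · rw [if_neg hgu, if_neg (fun h ↦ hgu (Units.val_injective h)), mul_zero]
  · have hne : ¬ Ideal.Quotient.mk 𝔮 p = (u : 𝓞 K ⧸ 𝔮) := fun h ↦ hunit (h ▸ u.isUnit)
    rw [if_neg hne]
    simp [unitValue_of_not_isUnit _ hunit]

/-- `|P(N)| = S(N, 𝔮, χ₀) + #{π ∈ P(N) : π not prime to 𝔮}`. [folklore] -/
theorem primesA_eq {𝔮 : Ideal (𝓞 K)} (N : ℝ) :
    (primesA K N : ℂ) = primeCharSum K N 𝔮 0 + badPrimes K N 𝔮 := by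
  unfold primesA primeCharSum badPrimes
  rw [← Finset.card_filter_add_card_filter_not (s := (regionF K N).filter Prime)
    (fun p ↦ IsUnit (Ideal.Quotient.mk 𝔮 p)), Nat.cast_add, Finset.filter_filter, Finset.filter_filter]
  congr 1
  rw [Finset.card_eq_sum_ones, Nat.cast_sum, Nat.cast_one, ← Finset.sum_filter_add_sum_filter_not
    ((regionF K N).filter Prime) (fun p ↦ IsUnit (Ideal.Quotient.mk 𝔮 p)), Finset.filter_filter, Finset.filter_filter]
  rw [Finset.sum_congr rfl fun p hp ↦ unitValue_zero_of_isUnit (Finset.mem_filter.1 hp).2.2,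
    Finset.sum_congr rfl fun p hp ↦ unitValue_of_not_isUnit (0 : AddChar (Additive ((𝓞 K ⧸ 𝔮)ˣ)) ℂ)
      (Finset.mem_filter.1 hp).2.2, Finset.sum_const_zero, add_zero]

/-- **Step A of Bombieri–Vinogradov over `𝓞_K`**:
`𝓔(N; 𝔮) ≤ φ(𝔮)⁻¹ (∑_{χ ≠ χ₀} |S(N, 𝔮, χ)| + #{π ∈ P(N) : π not prime to 𝔮})`.
[cite: CojocaruMurty2005, Thm. 9.2.1 (PDF p. 98)] -/
theorem primesAErr_le {𝔮 : Ideal (𝓞 K)} [Finite (𝓞 K ⧸ 𝔮)] (h𝔮 : 𝔮 ≠ ⊥) (N : ℝ) :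
    primesAErr K N 𝔮 ≤ (idealTotient K 𝔮)⁻¹ *
      ((∑ χ ∈ (Finset.univ : Finset (AddChar (Additive ((𝓞 K ⧸ 𝔮)ˣ)) ℂ)).erase 0, ‖primeCharSum K N 𝔮 χ‖) +
        badPrimes K N 𝔮) := by
  have hφ : idealTotient K 𝔮 = Nat.card ((𝓞 K ⧸ 𝔮)ˣ) := idealTotient_eq_natCard_units h𝔮
  have hφC : ((idealTotient K 𝔮 : ℝ) : ℂ) = (Nat.card ((𝓞 K ⧸ 𝔮)ˣ) : ℂ) := by rw [hφ]; push_cast; rfl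
  have hG0 : (0 : ℝ) < Nat.card ((𝓞 K ⧸ 𝔮)ˣ) := by exact_mod_cast Nat.card_pos
  have hGC : (Nat.card ((𝓞 K ⧸ 𝔮)ˣ) : ℂ) ≠ 0 := by exact_mod_cast hG0.ne'
  unfold primesAErr
  refine Real.iSup_le (fun u ↦ ?_) (by rw [hφ]; positivity)
  -- the class `u` through the characters
  have hmod := primesAModQ_eq_sum (K := K) N u
  have hall := primesA_eq (K := K) (𝔮 := 𝔮) N
  have hsplit : ∑ χ : AddChar (Additive ((𝓞 K ⧸ 𝔮)ˣ)) ℂ, (χ (Additive.ofMul u))⁻¹ * primeCharSum K N 𝔮 χ =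
      primeCharSum K N 𝔮 0 + ∑ χ ∈ (Finset.univ : Finset (AddChar (Additive ((𝓞 K ⧸ 𝔮)ˣ)) ℂ)).erase 0,
        (χ (Additive.ofMul u))⁻¹ * primeCharSum K N 𝔮 χ := by
    rw [← Finset.add_sum_erase _ _ (Finset.mem_univ (0 : AddChar (Additive ((𝓞 K ⧸ 𝔮)ˣ)) ℂ)),
      AddChar.zero_apply, inv_one, one_mul]
  -- the error as a complex number
  have hdiff : ((primesAModQ K N 𝔮 (u : 𝓞 K ⧸ 𝔮) : ℝ) - primesA K N / idealTotient K 𝔮 : ℂ) =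
      ((Nat.card ((𝓞 K ⧸ 𝔮)ˣ) : ℂ))⁻¹ *
        ((∑ χ ∈ (Finset.univ : Finset (AddChar (Additive ((𝓞 K ⧸ 𝔮)ˣ)) ℂ)).erase 0,
          (χ (Additive.ofMul u))⁻¹ * primeCharSum K N 𝔮 χ) - badPrimes K N 𝔮) := by
    push_cast
    rw [hmod, hall, hsplit, hφC]
    ring
  have hreal : |(primesAModQ K N 𝔮 (u : 𝓞 K ⧸ 𝔮) : ℝ) - primesA K N / idealTotient K 𝔮| =
      ‖((primesAModQ K N 𝔮 (u : 𝓞 K ⧸ 𝔮) : ℝ) - primesA K N / idealTotient K 𝔮 : ℂ)‖ := by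
    rw [← Real.norm_eq_abs, ← Complex.norm_real]; push_cast; rfl
  rw [hreal, hdiff, norm_mul, norm_inv, Complex.norm_natCast, hφ]
  refine mul_le_mul_of_nonneg_left ?_ (inv_nonneg.2 hG0.le)
  refine (norm_sub_le _ _).trans (add_le_add ((norm_sum_le _ _).trans (Finset.sum_le_sum fun χ _ ↦ ?_)) ?_)
  · rw [norm_mul, norm_inv, AddChar.norm_apply, inv_one, one_mul]
  · rw [Complex.norm_natCast]

/-! ## The primes not prime to `𝔮` -/

section TotallyReal

variable [IsTotallyReal K]

omit [IsTotallyReal K] in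
/-- A prime of `A(N)` which is not a unit mod `𝔮` generates a prime divisor of `𝔮`. [folklore] -/
theorem span_mem_factors_of_not_isUnit {𝔮 : Ideal (𝓞 K)} (h𝔮 : 𝔮 ≠ ⊥) {p : 𝓞 K} (hp : Prime p)
    (hu : ¬ IsUnit (Ideal.Quotient.mk 𝔮 p)) : Ideal.span {p} ∈ (normalizedFactors 𝔮).toFinset := by
  have h0 : p ≠ 0 := hp.ne_zero
  have hprime : (Ideal.span {p}).IsPrime := (Ideal.span_singleton_prime h0).2 hp
  have hne : Ideal.span {p} ≠ ⊥ := by rwa [Ne, Ideal.span_singleton_eq_bot]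
  have hmax : (Ideal.span {p}).IsMaximal := hprime.isMaximal hne
  rw [Multiset.mem_toFinset, Ideal.mem_normalizedFactors_iff h𝔮]
  refine ⟨hprime, ?_⟩
  -- `(p) ⊔ 𝔮` is proper (else `p` would be a unit mod `𝔮`), hence `= (p)` by maximality
  by_contra hle
  have hlt : Ideal.span {p} < Ideal.span {p} ⊔ 𝔮 :=
    lt_of_le_of_ne le_sup_left fun heq ↦ hle (le_sup_right.trans heq.ge)
  exact hu (isUnit_mk_of_sup_eq_top (hmax.1.2 _ hlt))

omit [IsTotallyReal K] in
/-- `A(N) ⊆ A₀(2N)`. [folklore] -/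
theorem mem_box₀_of_mem_regionF {N : ℝ} {α : 𝓞 K} (h : α ∈ regionF K N) : α ∈ box₀ K (2 * N) :=
  (mem_regionF.1 h).1

/-- **The primes of `A(N)` not prime to `𝔮` are few**: for `N ≥ 1`,
`#{π ∈ P(N) : π not prime to 𝔮} ≤ ω(𝔮) · C_K · (1 + log(2N))^{d−1}` with `C_K` depending only on
`K`. [cite: Hinz1988, §1] -/
theorem badPrimes_le :
    ∃ C : ℝ, 0 ≤ C ∧ ∀ (𝔮 : Ideal (𝓞 K)), 𝔮 ≠ ⊥ → ∀ N : ℝ, 1 ≤ N →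
      (badPrimes K N 𝔮 : ℝ) ≤ (normalizedFactors 𝔮).toFinset.card * C * (1 + Real.log (2 * N)) ^ finrank ℝ (logSpace K) := by
  -- the uniform bound for the shape function of the box in logarithmic coordinates
  obtain ⟨R₀, hR₀⟩ := (isBounded_logBox (K := K)).subset_closedBall 0
  set R : ℝ := max R₀ 0 with hRdef
  have hR : logBox K ⊆ Metric.closedBall 0 R := hR₀.trans (Metric.closedBall_subset_closedBall (le_max_left _ _))
  obtain ⟨C, hC0, hC⟩ := exists_shapeFun_le (L := posUnitLattice K) MeasureTheory.volume hR (le_max_right _ _)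
  have hd : (0 : ℝ) < finrank ℚ K := by exact_mod_cast finrank_pos (R := ℚ) (M := K)
  refine ⟨C, hC0, fun 𝔮 h𝔮 N hN ↦ ?_⟩
  have hN2 : 0 < 2 * N := by linarith
  set T := (normalizedFactors 𝔮).toFinset with hT
  -- fibrewise over the prime divisors of `𝔮`
  set B := (regionF K N).filter fun p ↦ Prime p ∧ ¬ IsUnit (Ideal.Quotient.mk 𝔮 p) with hB
  have hmaps : ∀ p ∈ B, Ideal.span {p} ∈ T := by
    intro p hp
    rw [hB, Finset.mem_filter] at hp
    exact span_mem_factors_of_not_isUnit h𝔮 hp.2.1 hp.2.2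
  have hfib : ∀ P ∈ T, (((B.filter fun p ↦ Ideal.span {p} = P).card : ℕ) : ℝ) ≤
      C * (1 + Real.log (2 * N)) ^ finrank ℝ (logSpace K) := by
    intro P _
    have hfin : ({α : 𝓞 K | α ∈ box₀ K (2 * N) ∧ Ideal.span {α} = P} : Set (𝓞 K)).Finite :=
      (finite_box₀ _).subset fun α h ↦ h.1
    have hle : (((B.filter fun p ↦ Ideal.span {p} = P).card : ℕ) : ℝ) ≤
        Nat.card {α : 𝓞 K // α ∈ box₀ K (2 * N) ∧ Ideal.span {α} = P} := by
      have hc : Nat.card {α : 𝓞 K // α ∈ box₀ K (2 * N) ∧ Ideal.span {α} = P} = hfin.toFinset.card :=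
        Nat.card_eq_card_finite_toFinset hfin
      rw [hc]
      exact_mod_cast Finset.card_le_card fun α hα ↦ by
        rw [Set.Finite.mem_toFinset]
        rw [Finset.mem_filter, hB, Finset.mem_filter] at hα
        exact ⟨mem_box₀_of_mem_regionF hα.1.1, hα.2⟩
    refine hle.trans ?_
    rcases Set.eq_empty_or_nonempty {α : 𝓞 K | α ∈ box₀ K (2 * N) ∧ Ideal.span {α} = P} with hempty | ⟨α₀, hα₀⟩
    · have : Nat.card {α : 𝓞 K // α ∈ box₀ K (2 * N) ∧ Ideal.span {α} = P} = 0 := by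
        have hc : Nat.card {α : 𝓞 K // α ∈ box₀ K (2 * N) ∧ Ideal.span {α} = P} = hfin.toFinset.card :=
          Nat.card_eq_card_finite_toFinset hfin
        rw [hc, Finset.card_eq_zero, ← Finset.coe_eq_empty, Set.Finite.coe_toFinset]
        exact hempty
      rw [this, Nat.cast_zero]
      have hlog : 0 ≤ Real.log (2 * N) := Real.log_nonneg (by linarith)
      exact mul_nonneg hC0 (pow_nonneg (by linarith) _)
    · obtain ⟨hP, h1, h2⟩ := span_mem_idealFamily (K := K) hα₀.1
      rw [hα₀.2] at hP h1 h2
      rw [card_fiber hN2 hP h2]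
      have hm1 : (1 : ℝ) ≤ Ideal.absNorm P := by exact_mod_cast h1
      have hs0 : 0 ≤ Real.log ((2 * N) ^ finrank ℚ K / Ideal.absNorm P) / finrank ℚ K := by
        refine div_nonneg (Real.log_nonneg ?_) hd.le
        rwa [le_div_iff₀ (by linarith), one_mul]
      have hsle : Real.log ((2 * N) ^ finrank ℚ K / Ideal.absNorm P) / finrank ℚ K ≤ Real.log (2 * N) := by
        rw [div_le_iff₀ hd, Real.log_div (pow_ne_zero _ hN2.ne') (by linarith), Real.log_pow]
        have : 0 ≤ Real.log (Ideal.absNorm P : ℝ) := Real.log_nonneg hm1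
        nlinarith
      refine (hC _ hs0 (logPt K P)).trans ?_
      have h1log : 0 ≤ 1 + Real.log ((2 * N) ^ finrank ℚ K / Ideal.absNorm P) / finrank ℚ K := by linarith
      exact mul_le_mul_of_nonneg_left (pow_le_pow_left₀ h1log (by linarith) _) hC0
  calc (badPrimes K N 𝔮 : ℝ) = ((B.card : ℕ) : ℝ) := by rw [badPrimes, hB]
    _ = ∑ P ∈ T, (((B.filter fun p ↦ Ideal.span {p} = P).card : ℕ) : ℝ) := by
        rw [Finset.card_eq_sum_card_fiberwise hmaps]; push_cast; rfl
    _ ≤ ∑ P ∈ T, C * (1 + Real.log (2 * N)) ^ finrank ℝ (logSpace K) := Finset.sum_le_sum hfib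
    _ = T.card * C * (1 + Real.log (2 * N)) ^ finrank ℝ (logSpace K) := by
        rw [Finset.sum_const, nsmul_eq_mul]; ring

end TotallyReal

end Literature.NumberTheory.Sieve.BoxPrimes

end
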